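import Mathlib
import Summits.Ventures.PercRepro2.Defs
import Summits.Ventures.PercRepro2.Graph
import Summits.Ventures.PercRepro2.Induced
import Summits.Ventures.PercRepro2.VdBKahn
import Summits.Ventures.PercRepro2.ReimerVdBK
import Summits.Ventures.PercRepro2.ReimerVdBKRegions
import Summits.Ventures.PercRepro2.ReimerVdBKZClosed
import Summits.Ventures.PercRepro2.ReimerVdBKZReduction
import Summits.Ventures.PercRepro2.ReimerVdBKZSplit
import Summits.Ventures.PercRepro2.ReimerVdBKZRecursion
import Summits.Ventures.PercRepro2.ReimerVdBKTypeWeight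

/-!
# The closed system of pair types, and the reduction of (R-1.2) to its Harris-pair core
(blind cell PercRepro2, mine-c g46; `conjectures/MINE-C.md` §55.3)

Both sides of (R-1.2) are product counts (`pcount`) of per-vertex type weights: a vertex of `A` carries
`(1,1,0,0)` on both sides, of `B` `(1,0,1,0)` on the left and `(1,1,0,0)` on the right, of `X` `(0,0,1,1)` /
`(0,1,0,1)`, of `Y` `(0,1,0,1)` / `(0,1,0,1)`, of `A ∩ Y` `(0,1,0,0)` / `(0,1,0,0)`, of `B ∩ X` `(0,0,1,0)` /
`(0,1,0,0)`, of `A ∩ B` `(1,0,0,0)` / `(1,1,0,0)`, of `X ∩ Y` `(0,0,0,1)` / `(0,0,0,1)`, an unmarked vertex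
`(1,1,1,1)` / `(1,1,1,1)` — the PAIR TYPES `A, B, X, Y, AY, BX, AB, Z, U`.  The one-edge split at a `Z`-vertex
multiplies the neighbour's pair by `(0,1,1,2)`: `U ↦ F 1`, `F k ↦ F (k+1)` (the frontier types
`F k = ((0,1,1,2^k), (0,1,1,2^k))`), `A ↦ AY`, `B ↦ BX`, `X ↦ X + Z`, `Y ↦ Y + Z`, `AY ↦ AY`, `BX ↦ BX`,
`Z ↦ 2·Z`, `AB ↦ (0, ·)` (the left side vanishes); and `F k = F 0 + (2^k − 1)·Z`.  So the system of pair
types `{A, B, X, Y, AY, BX, AB, Z, U} ∪ {F k}` is closed, and by induction on (non-loop edges, `∑ k`) every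
statement `pcount (lwt ∘ P) ≤ pcount (rwt ∘ P)` reduces to statements WITHOUT `Z` and without `F k`, `k ≥ 1`
— Harris pairs (`X ∩ Y = ∅`) weighted by `F 0 = (0,1,1,1)` at a set of unmarked vertices, i.e. the
Harris-pair case of the cell's (CORE↓) (`MINE-C.md` §53.4 (d)).  THEOREM `pstmt_of_harris`.
`ReimerVdBKCoreDown` states it in the cell's vocabulary.
-/

namespace Summit.Ventures.PercRepro2
namespace ReimerVdBK
open Classical

/-! ## Pair types -/

/-- The pair types: the left / right type weights of a vertex of an (R-1.2) instance, closed under the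
one-edge split. -/
inductive PairType
  | A | B | X | Y | AY | BX | AB | Z | U
  | F (k : ℕ)
  deriving DecidableEq

namespace PairType

/-- The left weight. -/
def lwt : PairType → TW
  | A => (1, 1, 0, 0) | B => (1, 0, 1, 0) | X => (0, 0, 1, 1) | Y => (0, 1, 0, 1)
  | AY => (0, 1, 0, 0) | BX => (0, 0, 1, 0) | AB => (1, 0, 0, 0) | Z => (0, 0, 0, 1)
  | U => (1, 1, 1, 1) | F k => (0, 1, 1, 2 ^ k)

/-- The right weight. -/
def rwt : PairType → TW
  | A => (1, 1, 0, 0) | B => (1, 1, 0, 0) | X => (0, 1, 0, 1) | Y => (0, 1, 0, 1)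
  | AY => (0, 1, 0, 0) | BX => (0, 1, 0, 0) | AB => (1, 1, 0, 0) | Z => (0, 0, 0, 1)
  | U => (1, 1, 1, 1) | F k => (0, 1, 1, 2 ^ k)

/-- The frontier index. -/
def kF : PairType → ℕ
  | F k => k
  | _ => 0

/-- The Harris class: no doubly-avoided vertex, no frontier index `≥ 1`. -/
def IsHarris : PairType → Prop
  | Z => False
  | F k => k = 0
  | _ => True

/-- The left and right weights agree on the type `C` (the root's type). -/
lemma lwt_fst_eq_rwt_fst (t : PairType) : (lwt t).1 = (rwt t).1 := by
  cases t <;> rfl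

/-! ### The split at a `Z`-neighbour: the pair types are closed -/

/-- The split of an `A`-vertex: it is pinned to world 1 (`AY`). -/
lemma split_A : tmul (lwt A) tSplit = lwt AY ∧ tmul (rwt A) tSplit = rwt AY := by
  constructor <;> rfl

/-- The split of a `B`-vertex: it is pinned away from world 1 on the left, to world 1 on the right (`BX`). -/
lemma split_B : tmul (lwt B) tSplit = lwt BX ∧ tmul (rwt B) tSplit = rwt BX := by
  constructor <;> rfl

/-- The split of an `X`-vertex: the instance plus the instance with the vertex doubly avoided. -/
lemma split_X : tmul (lwt X) tSplit = tadd (lwt X) (lwt Z) ∧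
    tmul (rwt X) tSplit = tadd (rwt X) (rwt Z) := by
  constructor <;> rfl

/-- The split of a `Y`-vertex: the instance plus the instance with the vertex doubly avoided. -/
lemma split_Y : tmul (lwt Y) tSplit = tadd (lwt Y) (lwt Z) ∧
    tmul (rwt Y) tSplit = tadd (rwt Y) (rwt Z) := by
  constructor <;> rfl

/-- The split of an `AY`-vertex: unchanged. -/
lemma split_AY : tmul (lwt AY) tSplit = lwt AY ∧ tmul (rwt AY) tSplit = rwt AY := by
  constructor <;> rfl

/-- The split of a `BX`-vertex: unchanged. -/
lemma split_BX : tmul (lwt BX) tSplit = lwt BX ∧ tmul (rwt BX) tSplit = rwt BX := by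
  constructor <;> rfl

/-- The split of an `AB`-vertex kills the left side. -/
lemma split_AB : tmul (lwt AB) tSplit = (0, 0, 0, 0) := rfl

/-- The split of a `Z`-vertex (a parallel edge or loop): the weight doubles. -/
lemma split_Z : tmul (lwt Z) tSplit = tsmul 2 (lwt Z) ∧ tmul (rwt Z) tSplit = tsmul 2 (rwt Z) := by
  constructor <;> rfl

/-- The split of an unmarked vertex: the frontier type `F 1`. -/
lemma split_U : tmul (lwt U) tSplit = lwt (F 1) ∧ tmul (rwt U) tSplit = rwt (F 1) := by
  constructor <;> rfl

/-- The split of a frontier vertex raises its index. -/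
lemma split_F (k : ℕ) : tmul (lwt (F k)) tSplit = lwt (F (k + 1)) ∧
    tmul (rwt (F k)) tSplit = rwt (F (k + 1)) := by
  constructor <;> simp [lwt, rwt, tmul, tSplit, pow_succ]

/-- The frontier weight decomposes: `F k = F 0 + (2^k − 1) · Z`. -/
lemma F_decomp (k : ℕ) : lwt (F k) = tadd (lwt (F 0)) (tsmul (2 ^ k - 1) (lwt Z)) ∧
    rwt (F k) = tadd (rwt (F 0)) (tsmul (2 ^ k - 1) (rwt Z)) := by
  have h : 1 + (2 ^ k - 1) = 2 ^ k := by
    have := Nat.one_le_two_pow (n := k)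
    omega
  constructor <;> simp [lwt, rwt, tadd, tsmul, h]

/-- The `Z`-weight is supported on the type `O`. -/
lemma lwt_Z_supp : (lwt Z).1 = 0 ∧ (lwt Z).2.1 = 0 ∧ (lwt Z).2.2.1 = 0 := ⟨rfl, rfl, rfl⟩

/-- The `Z`-weight is supported on the type `O`. -/
lemma rwt_Z_supp : (rwt Z).1 = 0 ∧ (rwt Z).2.1 = 0 ∧ (rwt Z).2.2.1 = 0 := ⟨rfl, rfl, rfl⟩

end PairType

open PairType

variable {V : Type*} {E : Type*} [Fintype E] [DecidableEq E] [Fintype V] [DecidableEq V]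
variable (ends : E → Sym2 V) (s : V)

/-- The pair statement of an assignment of pair types: the left product count is at most the right one. -/
def PStmt (P : V → PairType) : Prop :=
  pcount ends s (lwt ∘ P) ≤ pcount ends s (rwt ∘ P)

omit [Fintype E] [DecidableEq E] [Fintype V] in
/-- Updating the assignment and then taking weights is updating the weights. -/
lemma comp_update (f : PairType → TW) (P : V → PairType) (v : V) (t : PairType) :
    f ∘ Function.update P v t = Function.update (f ∘ P) v (f t) := by
  funext u
  by_cases huv : u = v
  · subst huv; simp
  · simp [Function.update_of_ne huv]

omit [Fintype E] [DecidableEq E] [Fintype V] in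
/-- Updating at `v` with the weight already there changes nothing. -/
lemma comp_update_self (f : PairType → TW) (P : V → PairType) (v : V) :
    Function.update (f ∘ P) v (f (P v)) = f ∘ P := by
  rw [← comp_update, Function.update_eq_self]

omit [Fintype E] [DecidableEq E] in
/-- The frontier measure of an assignment. -/
def kSum (P : V → PairType) : ℕ := ∑ v : V, (P v).kF

omit [Fintype E] [DecidableEq E] in
/-- The frontier measure after an update. -/
lemma kSum_update (P : V → PairType) (v : V) (t : PairType) :
    kSum (Function.update P v t) + (P v).kF = kSum P + t.kF := by
  unfold kSum
  have h1 : ∀ u, (Function.update P v t u).kF = Function.update (fun u => (P u).kF) v t.kF u := by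
    intro u
    by_cases huv : u = v
    · subst huv; simp
    · simp [Function.update_of_ne huv]
  simp only [h1]
  rw [Finset.sum_update_of_mem (Finset.mem_univ v), ← Finset.add_sum_erase Finset.univ _ (Finset.mem_univ v)]
  rw [Finset.sdiff_singleton_eq_erase]
  ring

/-! ## The reduction theorem -/

/-- A pair type other than `Z` with frontier index `0` is Harris. -/
lemma PairType.isHarris_of_ne_Z {t : PairType} (hZ : t ≠ Z) (hF : t.kF = 0) : t.IsHarris := by
  cases t <;> simp_all [IsHarris, kF]

/-- **The reduction of (R-1.2) to its Harris-pair core.**  If the pair statement holds for every Harris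
assignment (no `Z`, no `F k` with `k ≥ 1`) on every graph with the given vertex and edge types, then it
holds for every assignment on every such graph — in particular for every (R-1.2) instance. -/
theorem pstmt_of_harris
    (hH : ∀ (ends : E → Sym2 V) (P : V → PairType), (∀ v, (P v).IsHarris) → PStmt ends s P) :
    ∀ (ends : E → Sym2 V) (P : V → PairType), PStmt ends s P := by
  suffices H : ∀ N : ℕ, ∀ (ends : E → Sym2 V), (nonloop ends).card = N →
      ∀ K : ℕ, ∀ P : V → PairType, kSum P = K → PStmt ends s P from
    fun ends P => H _ ends rfl _ P rfl
  intro N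
  induction N using Nat.strong_induction_on with
  | _ N ihN =>
  intro ends hN K
  induction K using Nat.strong_induction_on with
  | _ K ihK =>
  intro P hK
  -- a root weight vanishing on `C`: both sides vanish
  by_cases hroot : (lwt (P s)).1 = 0
  · unfold PStmt
    rw [pcount_eq_zero_of_root ends s _ hroot]
    exact Nat.zero_le _
  -- Case 1: a frontier vertex with index `≥ 1`
  by_cases hF : ∃ v, 1 ≤ (P v).kF
  · obtain ⟨v, hv⟩ := hF
    obtain ⟨k, hk⟩ : ∃ k, P v = F k := by
      cases h : P v <;> simp [h, kF] at hv ⊢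
    rw [hk] at hv
    simp only [kF] at hv
    have hdec := F_decomp k
    -- the two sub-assignments have a smaller frontier measure
    have hsum0 : kSum (Function.update P v (F 0)) < K := by
      have := kSum_update P v (F 0)
      rw [hk, hK] at this
      simp only [kF] at this
      omega
    have hsumZ : kSum (Function.update P v Z) < K := by
      have := kSum_update P v Z
      rw [hk, hK] at this
      simp only [kF] at this
      omega
    have h0 := ihK _ hsum0 (Function.update P v (F 0)) rfl
    have hZ := ihK _ hsumZ (Function.update P v Z) rfl
    unfold PStmt at h0 hZ ⊢
    rw [comp_update, comp_update] at h0 hZ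
    rw [← comp_update_self lwt P v, ← comp_update_self rwt P v, hk, hdec.1, hdec.2, pcount_tadd,
      pcount_tadd, pcount_tsmul, pcount_tsmul]
    have := Nat.mul_le_mul_left (2 ^ k - 1) hZ
    omega
  push Not at hF
  -- Case 2: a doubly-avoided vertex with a non-loop edge
  by_cases hact : ∃ e z y, ends e = s(z, y) ∧ P z = Z ∧ y ≠ z
  · obtain ⟨e, z, y, hends, hz, hyz⟩ := hact
    have hsz : s ≠ z := by
      rintro rfl
      rw [hz] at hroot
      exact hroot rfl
    have hne : ¬ (ends e).IsDiag := by
      rw [hends, Sym2.mk_isDiag_iff]; exact fun h => hyz h.symm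
    have hcard : (nonloop (loopAt ends e z)).card < N := by
      rw [← hN]; exact card_nonloop_loopAt_lt ends hne z
    have ih : ∀ P' : V → PairType, PStmt (loopAt ends e z) s P' :=
      fun P' => ihN _ hcard (loopAt ends e z) rfl _ P' rfl
    have hL := pcount_split ends s (lwt ∘ P) hends hsz (by rw [Function.comp_apply, hz]; exact lwt_Z_supp)
    have hR := pcount_split ends s (rwt ∘ P) hends hsz (by rw [Function.comp_apply, hz]; exact rwt_Z_supp)
    simp only [Function.comp_apply] at hL hR
    unfold PStmt
    suffices h2 : 2 * pcount ends s (lwt ∘ P) ≤ 2 * pcount ends s (rwt ∘ P) by omega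
    rw [hL, hR]
    -- the new pair type of `y`
    cases hy : P y with
    | A => rw [split_A.1, split_A.2, ← comp_update, ← comp_update]; exact ih _
    | B => rw [split_B.1, split_B.2, ← comp_update, ← comp_update]; exact ih _
    | X =>
      rw [split_X.1, split_X.2, pcount_tadd, pcount_tadd, ← hy, comp_update_self, comp_update_self,
        ← comp_update, ← comp_update]
      exact Nat.add_le_add (ih _) (ih _)
    | Y =>
      rw [split_Y.1, split_Y.2, pcount_tadd, pcount_tadd, ← hy, comp_update_self, comp_update_self,
        ← comp_update, ← comp_update]
      exact Nat.add_le_add (ih _) (ih _)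
    | AY => rw [split_AY.1, split_AY.2, ← comp_update, ← comp_update]; exact ih _
    | BX => rw [split_BX.1, split_BX.2, ← comp_update, ← comp_update]; exact ih _
    | AB =>
      rw [split_AB, pcount_eq_zero_of_zero (loopAt ends e z) s _ y (Function.update_self _ _ _)]
      exact Nat.zero_le _
    | Z =>
      rw [split_Z.1, split_Z.2, pcount_tsmul, pcount_tsmul, ← hy, comp_update_self, comp_update_self]
      exact Nat.mul_le_mul_left 2 (ih _)
    | U => rw [split_U.1, split_U.2, ← comp_update, ← comp_update]; exact ih _
    | F k => rw [(split_F k).1, (split_F k).2, ← comp_update, ← comp_update]; exact ih _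
  push Not at hact
  -- Case 3: every doubly-avoided vertex is inert — replace it by `U` and use the hypothesis
  have hsZ : P s ≠ Z := fun h => hroot (by rw [h]; rfl)
  obtain ⟨P', hP'def⟩ : ∃ P' : V → PairType, P' = fun v => if P v = Z then U else P v := ⟨_, rfl⟩
  have hP' : ∀ v, (P' v).IsHarris := by
    intro v
    by_cases h : P v = Z
    · have hv : P' v = U := by rw [hP'def]; simp [h]
      rw [hv]; trivial
    · have hv : P' v = P v := by rw [hP'def]; simp [h]
      rw [hv]
      exact PairType.isHarris_of_ne_Z h (Nat.lt_one_iff.1 (hF v))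
  have hvw : ∀ (f : PairType → TW), f Z = (0, 0, 0, 1) → f U = (1, 1, 1, 1) →
      ∀ ω v, vw ends s (f ∘ P) ω v = vw ends s (f ∘ P') ω v := by
    intro f hfZ hfU ω v
    by_cases h : P v = Z
    · have hsv : s ≠ v := fun hs => hsZ (by rw [hs]; exact h)
      have hinert : ∀ e, v ∈ ends e → (ends e).IsDiag := by
        intro e he
        obtain ⟨y, hy⟩ := Sym2.mem_iff_exists.1 he
        rw [hy, Sym2.mk_isDiag_iff]
        exact (hact e v y hy h).symm
      have h1 := not_conn_of_loops_only ends s hinert hsv ω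
      have h2 := not_conn_of_loops_only ends s hinert hsv (compl ω)
      have hv : P' v = U := by rw [hP'def]; simp [h]
      unfold vw
      rw [Function.comp_apply, Function.comp_apply, h, hv, hfZ, hfU, cdec_eq_false h1, cdec_eq_false h2]
      rfl
    · have hv : P' v = P v := by rw [hP'def]; simp [h]
      unfold vw
      rw [Function.comp_apply, Function.comp_apply, hv]
  unfold PStmt
  rw [pcount_congr ends s _ _ (hvw lwt rfl rfl), pcount_congr ends s _ _ (hvw rwt rfl rfl)]
  exact hH ends P' hP'

end ReimerVdBK
end Summit.Ventures.PercRepro2
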